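import Summits.BirchSwinnertonDyer.BirchSwinnertonDyer.Theorems.Rank2Observatory2DescKillTernary

/-!
# BirchSwinnertonDyer — rank ≥ 2 observatory: KERNEL-2DESC kill layer (QK), split certificates

HONEST FRAMING: per-curve certified theorems and census instruments; no claim on BSD in rank ≥ 2.

Generic file of the KERNEL-2DESC-CL "QK" kill layer (cert-1 gen 26), fourth part: purely structural
lemmas that let a row prove a residue-tree certificate `qkCheck p ĝ fuel = true`
(`Rank2Observatory2DescKillQuartic`) or `conicCheck p κ fuel = true`
(`Rank2Observatory2DescKillTernary`) SUBTREE BY SUBTREE — one `decide +kernel` per subtree (each an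
auxiliary lemma checked by the kernel on its own) instead of one `decide` for the whole tree, so that
the kernel's memory stays bounded on the few trees of ~10⁴ evaluations with large coefficients:

* `all_range_zero`, `all_range_succ`, `all_range_two`, `all_range_three` — assembling
  `(List.range p).all P = true` from the values `P d = true`;
* `qnode_split`, `qkCheck_split` — a quartic-tree node from its `p` children, the certificate from its
  `p + 1` chart roots;
* `cnode_split`, `conicCheck_split` — the same for the ternary conic tree (`p²` children, three charts).

No mathematics beyond unfolding the tree recursions; soundness is untouched (`qkCert_sound`,
`conicCert_sound` consume the assembled equalities). [folklore]
-/

set_option linter.dupNamespace false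

namespace Summit.BirchSwinnertonDyer.BirchSwinnertonDyer.Rank2Observatory.TwoDescKill

/-! ### Assembling `List.all` over `List.range` -/

/-- `(List.range 0).all P` holds. [folklore] -/
theorem all_range_zero {P : ℕ → Bool} : ((List.range 0).all P) = true := by
  simp [List.range_zero]

/-- `(List.range (n+1)).all P` from `(List.range n).all P` and `P n`. [folklore] -/
theorem all_range_succ {n : ℕ} {P : ℕ → Bool} (h : ((List.range n).all P) = true)
    (hn : P n = true) : ((List.range (n + 1)).all P) = true := by
  rw [List.range_succ, List.all_append, h, List.all_cons, hn]; rfl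

/-- `(List.range 2).all P` from `P 0` and `P 1`. [folklore] -/
theorem all_range_two {P : ℕ → Bool} (h0 : P 0 = true) (h1 : P 1 = true) :
    ((List.range 2).all P) = true :=
  all_range_succ (all_range_succ all_range_zero h0) h1

/-- `(List.range 3).all P` from `P 0`, `P 1` and `P 2`. [folklore] -/
theorem all_range_three {P : ℕ → Bool} (h0 : P 0 = true) (h1 : P 1 = true) (h2 : P 2 = true) :
    ((List.range 3).all P) = true :=
  all_range_succ (all_range_two h0 h1) h2

/-! ### Quartic tree (`Rank2Observatory2DescKillQuartic`) -/

/-- A node of the quartic tree with fuel `f + 1` is certified by its `p` children. [folklore] -/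
theorem qnode_split {p : ℕ} {g : ℤ × ℤ × ℤ × ℤ × ℤ} {A : Bool} {f : ℕ} {w : ℤ} {k : ℕ}
    (h : ((List.range p).all fun d => qnode p g A f (w + (p : ℤ) ^ k * (d : ℤ)) (k + 1)) = true) :
    qnode p g A (f + 1) w k = true := by
  rw [qnode, h, Bool.or_true]

/-- The quartic certificate from its chart-`A` roots and its chart-`B` root. [folklore] -/
theorem qkCheck_split {p : ℕ} {g : ℤ × ℤ × ℤ × ℤ × ℤ} {fuel : ℕ}
    (hA : ((List.range p).all fun d => qnode p g true fuel (d : ℤ) 1) = true)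
    (hB : qnode p g false fuel 0 1 = true) : qkCheck p g fuel = true := by
  rw [qkCheck, hA, hB]; rfl

/-! ### Conic tree (`Rank2Observatory2DescKillTernary`) -/

/-- A node of the conic tree with fuel `f + 1` is certified by its `p²` children. [folklore] -/
theorem cnode_split {p : ℕ} {κ : ℤ × ℤ × ℤ × ℤ × ℤ × ℤ} {ch f : ℕ} {s t : ℤ} {k : ℕ}
    (h : ((List.range p).all fun d₁ => (List.range p).all fun d₂ =>
        cnode p κ ch f (s + (p : ℤ) ^ k * (d₁ : ℤ)) (t + (p : ℤ) ^ k * (d₂ : ℤ)) (k + 1)) = true) :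
    cnode p κ ch (f + 1) s t k = true := by
  rw [cnode, h, Bool.or_true]

/-- The conic certificate from its three charts. [folklore] -/
theorem conicCheck_split {p : ℕ} {κ : ℤ × ℤ × ℤ × ℤ × ℤ × ℤ} {fuel : ℕ}
    (h0 : ((List.range p).all fun d₁ => (List.range p).all fun d₂ =>
        cnode p κ 0 fuel (d₁ : ℤ) (d₂ : ℤ) 1) = true)
    (h1 : ((List.range p).all fun d₁ => cnode p κ 1 fuel (d₁ : ℤ) 0 1) = true)
    (h2 : cnode p κ 2 fuel 0 0 1 = true) : conicCheck p κ fuel = true := by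
  rw [conicCheck, h0, h1, h2]; rfl

end Summit.BirchSwinnertonDyer.BirchSwinnertonDyer.Rank2Observatory.TwoDescKill
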